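import Summits.ResolutionOfSingularities.ResolutionOfSingularities.Theorems.HironakaBridgeERSGlue
import Summits.ResolutionOfSingularities.ResolutionOfSingularities.Theorems.RadicialJungCleanModelsSufficeProof
import Summits.ResolutionOfSingularities.ResolutionOfSingularities.Theorems.RadicialJungCleanModelsSuffice
import Summits.ResolutionOfSingularities.ResolutionOfSingularities.Theorems.RadicialJungCleanModelsSufficeFrame
import Summits.ResolutionOfSingularities.ResolutionOfSingularities.Theorems.WeightedInvariantDescentPerfectToAllPicoverLink
import Literature.AlgebraicGeometry.Resolution.LogRegularResolutionGeneralHolds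
import HarnessLib

/-!
# RUNG B of LADDER-RESOLUTION after 2026-08-27: the summit's price BELOW Hironaka's perfect-field claim is
# ONE research item — pointwise log-clean models (`RadicialJung.CleanModels`, stmt-15917)

Cell `res-hironaka`, slot L-G8 W8.1 (seat res-L0-w81-pv-2 g3). HONEST FRAMING: everything here is OURS or pure
logic; `MainClaimPerfect` is the TYPED §1 candidate of H. Hironaka's 2017 manuscript read with §2's perfect base
field (`Literature.AlgebraicGeometry.Hironaka2017.S01Introduction.MainClaimPerfect`), consumed ONLY as a
hypothesis, never asserted [claim: Hironaka2017, status: under-review]; nothing is attributed to the manuscript.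

State of record before today (`HironakaBridgeERSGlue.lean`): GIVEN the typed candidate, the summit is EQUIVALENT
to crux stmt-0549 `Descent.DescentPerfectToAll` (`resolutionOfSingularities_iff_descentPerfectToAll_of_mainClaimPerfect`).
Today the tree proved Kato 1994 (10.4) and from it `RadicialJung.CleanResolves` (stmt-16286) and
`RadicialJung.CleanModelsSuffice` (stmt-15883); consequently `RadicialJung.CleanModels` (stmt-15917: POINTWISE
log-clean proper birational regular models of degree-`p` purely inseparable classes over ANY field, no boundary,
no rider) implies `Picover`, hence `DescentPerfectToAll` (`Theorems.descentPerfectToAll_of_cleanModels`,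
`DescentDescentPerfectToAllOfCleanModels.lean`).  This file records the two resulting PRICES of the summit:

* `resolutionOfSingularities_of_mainClaimPerfect_of_cleanModels` — typed §1 candidate (perfect `K`) ∧
  `CleanModels` ⟹ `ResolutionOfSingularities` (rung B with its residual debt B2 replaced by item 15917);
* `resolutionOfSingularities_of_pialt_of_cleanModels` — WITHOUT the manuscript: `RadicialJung.Pialt`
  (purely inseparable regular alterations, Abramovich–Oort / Temkin 2013 Conj. 1.3.1) ∧ `CleanModels` ⟹
  `ResolutionOfSingularities` (RadicialJung's assembly with its crux `CleanModelsSuffice` now PROVED).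

No new mathematics; cruxes 0549, 0554, 0555 (`Pialt`), 15917 remain open.
-/

noncomputable section

set_option linter.dupNamespace false -- mandated namespace of this single-conjunct summit

open CategoryTheory AlgebraicGeometry
open Literature.AlgebraicGeometry.Resolution

namespace Summit.ResolutionOfSingularities.ResolutionOfSingularities.Theorems

/-- **Rung B priced by ONE research item.** GIVEN the typed §1 candidate of the manuscript over perfect base
fields (`MainClaimPerfect`, hypothesis only) AND pointwise log-clean models (`RadicialJung.CleanModels`,
stmt-15917), the summit `ResolutionOfSingularities` follows: `CleanModels ⇒ CleanResolves`-residue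
(exceptionalisation game + Kato 1994 (10.4), both theorems) `⇒ Picover ⇒ DescentPerfectToAll`
(`descentPerfectToAll_of_picover`), then `resolutionOfSingularities_of_mainClaimPerfect_of_descentPerfectToAll`.
OURS; not a statement of the manuscript. [folklore] -/
theorem resolutionOfSingularities_of_mainClaimPerfect_of_cleanModels
    (hH : Literature.AlgebraicGeometry.Hironaka2017.S01Introduction.MainClaimPerfect.{0})
    (hCM : Summit.ResolutionOfSingularities.ResolutionOfSingularities.Theses.RadicialJung.CleanModels) :
    _root_.ResolutionOfSingularities := by
  -- `CleanResolves` (stmt-16286), re-derived from the built modules: `π = 𝟙` case by the game + Kato (10.4)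
  have hCR : Summit.ResolutionOfSingularities.ResolutionOfSingularities.Theses.RadicialJung.CleanResolves := by
    refine RadicialJung.CleanResolves.cleanResolves_of_self ?_
    intro p hp k _ _ V _ f L _ _ hsep hloc hqc hVreg hPI hdeg hclean
    haveI := hsep; haveI := hloc; haveI := hqc; haveI := hPI
    obtain ⟨V', hV'int, π', hdom, hprop, hbir, S, hend⟩ :=
      RadicialJung.CleanModelsSuffice.endState_exists p hp k V f L hVreg hdeg hclean
    haveI := hV'int; haveI := hdom; haveI := hprop
    exact RadicialJung.CleanModelsSuffice.stub_gameEndResolves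
      Kato1994_logRegularScheme_hasResolution_holds.{0} p hp k V f L hdeg V' π' hbir S hend
  -- `CleanModels ⇒ Picover`
  have hPic : Summit.ResolutionOfSingularities.ResolutionOfSingularities.Theses.PAlteration.Picover := by
    intro p hp k _ _ Y X f g hsep hlft hqc hY hYreg hX hfin hui hsurj
    have hDegP : ∀ (k : Type) [Field k] [CharP k p] (W : Scheme.{0}) [IsIntegral W]
        (f : W ⟶ Spec (.of k)) (L : Type) [Field L] [Algebra W.functionField L],
        IsSeparated f → LocallyOfFiniteType f → QuasiCompact f → Scheme.IsRegular W →
        IsPurelyInseparable W.functionField L → Module.finrank W.functionField L = p →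
        Scheme.HasResolution (normalizationIn W L) := by
      intro k _ _ W _ f L _ _ hs hl hq hr hpi hd
      obtain ⟨V, π, hVi, hdom, hV⟩ := hCM p hp k W f L hs hl hq hr hpi hd
      exact hCR p hp k W f L hs hl hq hr hpi hd V π hV
    exact RadicialJung.CleanModelsSuffice.picoverAt_of_degPAt p hp hDegP k Y X f g hsep hlft hqc hY
      hYreg hX hfin hui hsurj
  exact resolutionOfSingularities_of_mainClaimPerfect_of_descentPerfectToAll hH
    (fun p hp H => descentPerfectToAll_of_picover hPic p hp H)

/-- **The summit from `Pialt` and `CleanModels`, without the manuscript**: route RadicialJung's assembly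
`CleanModels → Pialt → CleanModelsSuffice → ResolutionOfSingularities` with its crux `CleanModelsSuffice`
(stmt-15883) PROVED (`cleanModelsSuffice_proof`, 2026-08-27), leaving the two research cruxes `Pialt`
(stmt-0555) and `CleanModels` (stmt-15917) as hypotheses. [folklore] -/
theorem resolutionOfSingularities_of_pialt_of_cleanModels
    (hPI : Summit.ResolutionOfSingularities.ResolutionOfSingularities.Theses.RadicialJung.Pialt)
    (hCM : Summit.ResolutionOfSingularities.ResolutionOfSingularities.Theses.RadicialJung.CleanModels) :
    _root_.ResolutionOfSingularities :=
  _root_.ResolutionOfSingularities_iff.mpr fun p hp => cleanModelsSuffice_proof p hp (hPI p hp) (hCM p hp)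

end Summit.ResolutionOfSingularities.ResolutionOfSingularities.Theorems

end
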